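import Mathlib

/-!
# PercRepro — HALL'S CONDITION FOR «DISJOINTNESS» ON A FAMILY OF PAIRS (the abstract lemma (G))
(p10, gen 4; `proofs/P10-HALLROW.md` §5)

Let `𝒞` be a family of 2-element sets.  Its DISJOINTNESS relation is `C ~ C' ⟺ C ∩ C' = ∅`.  The lemma says
that Hall's condition holds for this relation — every sub-family `𝒜 ⊆ 𝒞` has at least `#𝒜` members of `𝒞`
disjoint from some member of `𝒜` — as soon as
* (G1) every member of `𝒞` is disjoint from at least `4` members of `𝒞`,
* (G2) `2 · deg(p) + 1 ≤ #𝒞` for every point `p` (`deg(p)` = the members through `p`), and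
* (G3) `6 ≤ #𝒞`.

Proof (`hall_disjoint_pairs`).  Write `𝒜^⊥` for the members meeting every member of `𝒜`; the claim is
`#𝒜 + #𝒜^⊥ ≤ #𝒞`.  If `𝒜` has two disjoint members `B₁, B₂`, every `C ∈ 𝒜^⊥` takes one point from each, so
`#𝒜^⊥ ≤ 4`; and if moreover `#𝒜 ≥ #𝒞 − 3` then `𝒜^⊥ = ∅`, because a `C ∈ 𝒜^⊥` is disjoint from `≥ 4` members,
none of which can lie in `𝒜`.  Otherwise `𝒜` is pairwise intersecting: it is a STAR (all members through one point
`p`; then `𝒜^⊥` lies in the star of `p` plus at most one pair, and (G2) closes) or it lies in a TRIANGLE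
`{ab, bc, ac}` (then `𝒜^⊥` lies in the same triangle and (G3) closes).

This is the base lemma of the Hall form of the row `q = 2` (ProfileTwoHall: `HallBase`): on a simple matroid with
`u + 2` elements the pairs with independent complement satisfy (G1)–(G3) except in eight finite configurations
(P10-HALLROW.md §5); that verification is NOT in this file.

* `disjFrom 𝒞 C` — the members of `𝒞` disjoint from `C`;  `deg 𝒞 p` — the members through `p`;
  `nbr 𝒞 𝒜` — the members disjoint from some member of `𝒜`;  `perp 𝒞 𝒜` — the members meeting every member of `𝒜`;
* `eq_pair_of_mem`, `subset_triple_of_meets` — two facts about 2-sets;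
* `card_perp_le_four_of_disjoint`, `perp_eq_empty_of_large`, `star_bound`, `triangle_bound` — the cases;
* **`hall_disjoint_pairs`** — the lemma.
-/

namespace PercRepro.HallDisjoint

open Finset

variable {α : Type} [DecidableEq α]

/-- The members of `𝒞` disjoint from `C`. -/
def disjFrom (𝒞 : Finset (Finset α)) (C : Finset α) : Finset (Finset α) := 𝒞.filter (fun C' => Disjoint C C')

/-- The number of members of `𝒞` through the point `p`. -/
def deg (𝒞 : Finset (Finset α)) (p : α) : ℕ := (𝒞.filter (fun C => p ∈ C)).card

/-- The members of `𝒞` disjoint from some member of `𝒜`. -/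
def nbr (𝒞 𝒜 : Finset (Finset α)) : Finset (Finset α) := 𝒞.filter (fun C => ∃ B ∈ 𝒜, Disjoint B C)

/-- The members of `𝒞` meeting every member of `𝒜`. -/
def perp (𝒞 𝒜 : Finset (Finset α)) : Finset (Finset α) := 𝒞.filter (fun C => ∀ B ∈ 𝒜, ¬ Disjoint B C)

/-- `#nbr + #perp = #𝒞`. -/
theorem card_nbr_add_card_perp (𝒞 𝒜 : Finset (Finset α)) : (nbr 𝒞 𝒜).card + (perp 𝒞 𝒜).card = 𝒞.card := by
  unfold nbr perp
  rw [← card_filter_add_card_filter_not (s := 𝒞) (fun C => ∃ B ∈ 𝒜, Disjoint B C)]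
  congr 2
  ext C
  simp only [not_exists, not_and]

/-- A 2-set containing two distinct points is that pair. -/
theorem eq_pair_of_mem {C : Finset α} (hC : C.card = 2) {x y : α} (hx : x ∈ C) (hy : y ∈ C) (hxy : x ≠ y) :
    C = {x, y} := by
  symm
  apply eq_of_subset_of_card_le
  · intro w hw
    rw [mem_insert, mem_singleton] at hw
    rcases hw with rfl | rfl
    · exact hx
    · exact hy
  · rw [hC, card_pair hxy]

/-- A 2-set containing `x` is `{x, y}` for some `y ≠ x`. -/
theorem exists_other {C : Finset α} (hC : C.card = 2) {x : α} (hx : x ∈ C) :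
    ∃ y ∈ C, y ≠ x ∧ C = {x, y} := by
  have h1 : 1 < C.card := by omega
  obtain ⟨y₁, y₂, hy₁, hy₂, hne⟩ := one_lt_card_iff.1 h1
  by_cases h : y₁ = x
  · refine ⟨y₂, hy₂, fun h' => hne (h.trans h'.symm), ?_⟩
    exact eq_pair_of_mem hC hx hy₂ (fun h' => hne (h.trans h'))
  · exact ⟨y₁, hy₁, h, eq_pair_of_mem hC hx hy₁ (Ne.symm h)⟩

/-- A 2-set meeting the three sides of a triangle `{a,b,c}` (three distinct points) lies in the triangle. -/
theorem subset_triple_of_meets {C : Finset α} (hC : C.card = 2) {a b c : α} (hab : a ≠ b) (hbc : b ≠ c)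
    (hac : a ≠ c) (h₀ : ¬ Disjoint ({a, b} : Finset α) C) (h₁ : ¬ Disjoint ({b, c} : Finset α) C)
    (h₂ : ¬ Disjoint ({a, c} : Finset α) C) : C ⊆ {a, b, c} := by
  rw [not_disjoint_iff] at h₀ h₁ h₂
  obtain ⟨x₀, hx₀, hx₀C⟩ := h₀
  obtain ⟨x₁, hx₁, hx₁C⟩ := h₁
  obtain ⟨x₂, hx₂, hx₂C⟩ := h₂
  simp only [mem_insert, mem_singleton] at hx₀ hx₁ hx₂
  by_cases ha : a ∈ C
  · obtain ⟨d, hdC, hda, hCeq⟩ := exists_other hC ha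
    have hx₁d : x₁ = d := by
      rw [hCeq, mem_insert, mem_singleton] at hx₁C
      rcases hx₁C with h | h
      · exfalso
        rcases hx₁ with rfl | rfl
        · exact hab h.symm
        · exact hac h.symm
      · exact h
    rw [hCeq]
    intro w hw
    rw [mem_insert, mem_singleton] at hw
    simp only [mem_insert, mem_singleton]
    rcases hw with rfl | rfl
    · exact Or.inl rfl
    · rw [← hx₁d]
      rcases hx₁ with rfl | rfl
      · exact Or.inr (Or.inl rfl)
      · exact Or.inr (Or.inr rfl)
  · have hb : b ∈ C := by
      rcases hx₀ with rfl | rfl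
      · exact absurd hx₀C ha
      · exact hx₀C
    have hc : c ∈ C := by
      rcases hx₂ with rfl | rfl
      · exact absurd hx₂C ha
      · exact hx₂C
    rw [eq_pair_of_mem hC hb hc hbc]
    intro w hw
    rw [mem_insert, mem_singleton] at hw
    simp only [mem_insert, mem_singleton]
    rcases hw with rfl | rfl
    · exact Or.inr (Or.inl rfl)
    · exact Or.inr (Or.inr rfl)

/-! ### The case of two disjoint members -/

/-- If `𝒜` has two disjoint members then at most four members of `𝒞` meet every member of `𝒜`. -/
theorem card_perp_le_four_of_disjoint {𝒞 𝒜 : Finset (Finset α)} (hpair : ∀ C ∈ 𝒞, C.card = 2)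
    {B₁ B₂ : Finset α} (hB₁ : B₁ ∈ 𝒜) (hB₂ : B₂ ∈ 𝒜) (h1 : B₁.card = 2) (h2 : B₂.card = 2)
    (hd : Disjoint B₁ B₂) : (perp 𝒞 𝒜).card ≤ 4 := by
  calc (perp 𝒞 𝒜).card ≤ ((B₁ ×ˢ B₂).image (fun x : α × α => ({x.1, x.2} : Finset α))).card := by
        apply card_le_card
        intro C hC
        unfold perp at hC
        rw [mem_filter] at hC
        obtain ⟨hC𝒞, hmeet⟩ := hC
        have hm1 := hmeet B₁ hB₁
        have hm2 := hmeet B₂ hB₂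
        rw [not_disjoint_iff] at hm1 hm2
        obtain ⟨b₁, hb₁, hb₁C⟩ := hm1
        obtain ⟨b₂, hb₂, hb₂C⟩ := hm2
        have hne : b₁ ≠ b₂ := fun h => disjoint_left.1 hd hb₁ (h ▸ hb₂)
        rw [mem_image]
        exact ⟨(b₁, b₂), mem_product.2 ⟨hb₁, hb₂⟩, (eq_pair_of_mem (hpair C hC𝒞) hb₁C hb₂C hne).symm⟩
    _ ≤ (B₁ ×ˢ B₂).card := card_image_le
    _ = 4 := by rw [card_product, h1, h2]

/-- If `𝒜 ⊆ 𝒞` misses at most three members of `𝒞` and (G1) holds, no member meets every member of `𝒜`. -/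
theorem perp_eq_empty_of_large {𝒞 𝒜 : Finset (Finset α)} (h𝒜 : 𝒜 ⊆ 𝒞)
    (hG1 : ∀ C ∈ 𝒞, 4 ≤ (disjFrom 𝒞 C).card) (hbig : 𝒞.card ≤ 𝒜.card + 3) : perp 𝒞 𝒜 = ∅ := by
  rw [eq_empty_iff_forall_notMem]
  intro C hC
  unfold perp at hC
  rw [mem_filter] at hC
  have hD : disjFrom 𝒞 C ⊆ 𝒞 \ 𝒜 := by
    intro C' hC'
    unfold disjFrom at hC'
    rw [mem_filter] at hC'
    rw [mem_sdiff]
    exact ⟨hC'.1, fun hA => hC.2 C' hA hC'.2.symm⟩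
  have h1 := card_le_card hD
  rw [card_sdiff_of_subset h𝒜] at h1
  have h2 := hG1 C hC.1
  omega

/-! ### The intersecting cases -/

/-- The STAR case: if every member of the nonempty `𝒜 ⊆ 𝒞` contains `p`, then `#𝒜 + #perp ≤ #𝒞` under (G2). -/
theorem star_bound {𝒞 𝒜 : Finset (Finset α)} (hpair : ∀ C ∈ 𝒞, C.card = 2) (h𝒜 : 𝒜 ⊆ 𝒞)
    (hG2 : ∀ p, 2 * deg 𝒞 p + 1 ≤ 𝒞.card) {p : α} (hp : ∀ B ∈ 𝒜, p ∈ B) (hne : 𝒜.Nonempty) :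
    𝒜.card + (perp 𝒞 𝒜).card ≤ 𝒞.card := by
  have h𝒜deg : 𝒜.card ≤ deg 𝒞 p := by
    unfold deg
    apply card_le_card
    intro B hB
    rw [mem_filter]
    exact ⟨h𝒜 hB, hp B hB⟩
  rcases Nat.lt_or_ge 1 𝒜.card with hlt | hle
  · obtain ⟨B₁, B₂, hB₁, hB₂, hB12⟩ := one_lt_card_iff.1 hlt
    obtain ⟨a, haB₁, hap, hB₁eq⟩ := exists_other (hpair B₁ (h𝒜 hB₁)) (hp B₁ hB₁)
    obtain ⟨b, hbB₂, hbp, hB₂eq⟩ := exists_other (hpair B₂ (h𝒜 hB₂)) (hp B₂ hB₂)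
    have hab : a ≠ b := by
      intro h
      apply hB12
      rw [hB₁eq, hB₂eq, h]
    have hP : perp 𝒞 𝒜 ⊆ 𝒞.filter (fun C => p ∈ C) ∪ {({a, b} : Finset α)} := by
      intro C hC
      unfold perp at hC
      rw [mem_filter] at hC
      rw [mem_union, mem_filter, mem_singleton]
      by_cases hpC : p ∈ C
      · exact Or.inl ⟨hC.1, hpC⟩
      · right
        have m1 := hC.2 B₁ hB₁
        have m2 := hC.2 B₂ hB₂
        rw [not_disjoint_iff] at m1 m2
        obtain ⟨x, hx, hxC⟩ := m1
        obtain ⟨y, hy, hyC⟩ := m2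
        rw [hB₁eq, mem_insert, mem_singleton] at hx
        rw [hB₂eq, mem_insert, mem_singleton] at hy
        have hxa : x = a := by
          rcases hx with rfl | rfl
          · exact absurd hxC hpC
          · rfl
        have hyb : y = b := by
          rcases hy with rfl | rfl
          · exact absurd hyC hpC
          · rfl
        subst hxa
        subst hyb
        exact eq_pair_of_mem (hpair C hC.1) hxC hyC hab
    have h1 := card_le_card hP
    have h3 : (𝒞.filter (fun C => p ∈ C) ∪ {({a, b} : Finset α)}).card ≤ deg 𝒞 p + 1 := by
      calc (𝒞.filter (fun C => p ∈ C) ∪ {({a, b} : Finset α)}).card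
          ≤ (𝒞.filter (fun C => p ∈ C)).card + ({({a, b} : Finset α)} : Finset (Finset α)).card :=
            card_union_le _ _
        _ = deg 𝒞 p + 1 := by rw [card_singleton]; rfl
    have h4 := hG2 p
    omega
  · obtain ⟨B₀, hB₀⟩ := hne
    have hcard1 : 𝒜.card = 1 := by
      have := card_pos.2 ⟨B₀, hB₀⟩
      omega
    obtain ⟨a, b, hab, hB₀eq⟩ := card_eq_two.1 (hpair B₀ (h𝒜 hB₀))
    have hP : perp 𝒞 𝒜 ⊆ 𝒞.filter (fun C => a ∈ C) ∪ 𝒞.filter (fun C => b ∈ C) := by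
      intro C hC
      unfold perp at hC
      rw [mem_filter] at hC
      have m := hC.2 B₀ hB₀
      rw [not_disjoint_iff] at m
      obtain ⟨x, hx, hxC⟩ := m
      rw [hB₀eq, mem_insert, mem_singleton] at hx
      rw [mem_union, mem_filter, mem_filter]
      rcases hx with rfl | rfl
      · exact Or.inl ⟨hC.1, hxC⟩
      · exact Or.inr ⟨hC.1, hxC⟩
    have h1 := card_le_card hP
    have h2 := card_union_le (𝒞.filter (fun C => a ∈ C)) (𝒞.filter (fun C => b ∈ C))
    have ha := hG2 a
    have hb := hG2 b
    unfold deg at ha hb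
    omega

/-- The TRIANGLE case: if `𝒜 ⊆ 𝒞` is pairwise intersecting and contains the three sides of a triangle, then
`#𝒜 + #perp ≤ 6 ≤ #𝒞` under (G3). -/
theorem triangle_bound {𝒞 𝒜 : Finset (Finset α)} (hpair : ∀ C ∈ 𝒞, C.card = 2) (h𝒜 : 𝒜 ⊆ 𝒞)
    (hG3 : 6 ≤ 𝒞.card) {a b c : α} (hab : a ≠ b) (hbc : b ≠ c) (hac : a ≠ c)
    (h0 : ({a, b} : Finset α) ∈ 𝒜) (h1 : ({b, c} : Finset α) ∈ 𝒜) (h2 : ({a, c} : Finset α) ∈ 𝒜)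
    (hint : ∀ B₁ ∈ 𝒜, ∀ B₂ ∈ 𝒜, ¬ Disjoint B₁ B₂) :
    𝒜.card + (perp 𝒞 𝒜).card ≤ 𝒞.card := by
  have hTcard : (({a, b, c} : Finset α).powersetCard 2).card = 3 := by
    rw [card_powersetCard]
    have h3 : ({a, b, c} : Finset α).card = 3 := by
      rw [card_insert_of_notMem, card_pair hbc]
      rw [mem_insert, mem_singleton]
      rintro (h | h)
      · exact hab h
      · exact hac h
    rw [h3]
    rfl
  have hAT : 𝒜 ⊆ ({a, b, c} : Finset α).powersetCard 2 := by
    intro B hB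
    rw [mem_powersetCard]
    exact ⟨subset_triple_of_meets (hpair B (h𝒜 hB)) hab hbc hac (hint _ h0 B hB) (hint _ h1 B hB)
      (hint _ h2 B hB), hpair B (h𝒜 hB)⟩
  have hPT : perp 𝒞 𝒜 ⊆ ({a, b, c} : Finset α).powersetCard 2 := by
    intro C hC
    unfold perp at hC
    rw [mem_filter] at hC
    rw [mem_powersetCard]
    exact ⟨subset_triple_of_meets (hpair C hC.1) hab hbc hac (hC.2 _ h0) (hC.2 _ h1) (hC.2 _ h2),
      hpair C hC.1⟩
  have := card_le_card hAT
  have := card_le_card hPT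
  omega

/-! ### The lemma -/

/-- **Hall's condition for disjointness on a family of pairs.**  If every member of `𝒞` is disjoint from at
least four members (G1), `2 · deg(p) + 1 ≤ #𝒞` for every point (G2) and `6 ≤ #𝒞` (G3), then every `𝒜 ⊆ 𝒞` has at
least `#𝒜` members of `𝒞` disjoint from some member of `𝒜`. -/
theorem hall_disjoint_pairs (𝒞 : Finset (Finset α)) (hpair : ∀ C ∈ 𝒞, C.card = 2)
    (hG1 : ∀ C ∈ 𝒞, 4 ≤ (disjFrom 𝒞 C).card) (hG2 : ∀ p, 2 * deg 𝒞 p + 1 ≤ 𝒞.card) (hG3 : 6 ≤ 𝒞.card)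
    {𝒜 : Finset (Finset α)} (h𝒜 : 𝒜 ⊆ 𝒞) : 𝒜.card ≤ (nbr 𝒞 𝒜).card := by
  have hsplit := card_nbr_add_card_perp 𝒞 𝒜
  suffices h : 𝒜.card + (perp 𝒞 𝒜).card ≤ 𝒞.card by omega
  rcases 𝒜.eq_empty_or_nonempty with h0 | hne
  · subst h0
    have : perp 𝒞 ∅ ⊆ 𝒞 := filter_subset _ _
    have := card_le_card this
    rw [card_empty]
    omega
  by_cases hdis : ∃ B₁ ∈ 𝒜, ∃ B₂ ∈ 𝒜, Disjoint B₁ B₂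
  · obtain ⟨B₁, hB₁, B₂, hB₂, hd⟩ := hdis
    have h4 := card_perp_le_four_of_disjoint (𝒞 := 𝒞) hpair hB₁ hB₂ (hpair _ (h𝒜 hB₁)) (hpair _ (h𝒜 hB₂)) hd
    rcases Nat.lt_or_ge (𝒜.card + 3) 𝒞.card with hlt | hge
    · omega
    · rw [perp_eq_empty_of_large h𝒜 hG1 hge, card_empty]
      have := card_le_card h𝒜
      omega
  · have hint : ∀ B₁ ∈ 𝒜, ∀ B₂ ∈ 𝒜, ¬ Disjoint B₁ B₂ :=
      fun B₁ h1 B₂ h2 hd => hdis ⟨B₁, h1, B₂, h2, hd⟩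
    obtain ⟨B₀, hB₀⟩ := hne
    obtain ⟨a, b, hab, hB₀eq⟩ := card_eq_two.1 (hpair B₀ (h𝒜 hB₀))
    by_cases hstara : ∀ B ∈ 𝒜, a ∈ B
    · exact star_bound hpair h𝒜 hG2 hstara ⟨B₀, hB₀⟩
    · obtain ⟨B₁, hB₁, haB₁⟩ : ∃ B ∈ 𝒜, a ∉ B := by
        by_contra hcon
        apply hstara
        intro B hB
        by_contra h
        exact hcon ⟨B, hB, h⟩
      have hbB₁ : b ∈ B₁ := by
        have m := hint B₀ hB₀ B₁ hB₁
        rw [not_disjoint_iff] at m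
        obtain ⟨x, hx, hxB₁⟩ := m
        rw [hB₀eq, mem_insert, mem_singleton] at hx
        rcases hx with rfl | rfl
        · exact absurd hxB₁ haB₁
        · exact hxB₁
      obtain ⟨c, hcB₁, hcb, hB₁eq⟩ := exists_other (hpair B₁ (h𝒜 hB₁)) hbB₁
      have hac : a ≠ c := fun h => haB₁ (h ▸ hcB₁)
      by_cases hstarb : ∀ B ∈ 𝒜, b ∈ B
      · exact star_bound hpair h𝒜 hG2 hstarb ⟨B₀, hB₀⟩
      · obtain ⟨B₂, hB₂, hbB₂⟩ : ∃ B ∈ 𝒜, b ∉ B := by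
          by_contra hcon
          apply hstarb
          intro B hB
          by_contra h
          exact hcon ⟨B, hB, h⟩
        have haB₂ : a ∈ B₂ := by
          have m := hint B₀ hB₀ B₂ hB₂
          rw [not_disjoint_iff] at m
          obtain ⟨x, hx, hxB₂⟩ := m
          rw [hB₀eq, mem_insert, mem_singleton] at hx
          rcases hx with rfl | rfl
          · exact hxB₂
          · exact absurd hxB₂ hbB₂
        have hcB₂ : c ∈ B₂ := by
          have m := hint B₁ hB₁ B₂ hB₂
          rw [not_disjoint_iff] at m
          obtain ⟨x, hx, hxB₂⟩ := m
          rw [hB₁eq, mem_insert, mem_singleton] at hx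
          rcases hx with rfl | rfl
          · exact absurd hxB₂ hbB₂
          · exact hxB₂
        have hB₂eq : B₂ = {a, c} := eq_pair_of_mem (hpair B₂ (h𝒜 hB₂)) haB₂ hcB₂ hac
        rw [hB₀eq] at hB₀
        rw [hB₁eq] at hB₁
        rw [hB₂eq] at hB₂
        exact triangle_bound hpair h𝒜 hG3 hab (Ne.symm hcb) hac hB₀ hB₁ hB₂ hint

end PercRepro.HallDisjoint
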